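import Summits.ResolutionOfSingularities.ResolutionOfSingularities.Theorems.PurelyInseparableDim4Scope
import Mathlib.Data.Nat.Choose.Lucas
import HarnessLib

/-!
# [OURS · res-dim4-pi F4-I dictionary] Cleaning is inert for the `p`-fold locus: Hasse derivatives of
  order `< p` do not see `p`-th power monomials

Cell `res-dim4-pi` (D-0157 DOOR 2), frame v4 TIER 1 (I); seat `res-dim4-p-5`. Def-free. Item K1 of the μ₂-drop
memo (HOME/res-dim4-p-5/memo/F4I-22-MU-DROP.md): the `q`-fold locus ideal `J_q⁺(F) = ⟨D^{(α)}F : 0 < |α| < q⟩`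
of the Scope add-on, at `q = p` prime in characteristic `p`, is unchanged by the frame's cleaning
`Hauser2010.deletePthPowers p` (and, more generally, by adding any polynomial supported on `p`-th power exponents):
Lucas' theorem `C(p·m, a) ≡ 0 (mod p)` for `0 < a < p`.

* §1 `coeff_hasseDeriv` — the coefficient formula `coeff_e (D^{(α)} F) = (∏ᵢ C(eᵢ + αᵢ, αᵢ)) · coeff_{e+α} F`;
  `hasseDeriv_add`, `hasseDeriv_zero`.
* §2 `prod_choose_eq_zero_of_isPthPowerExponent` — for a `p`-th power exponent `d` and `0 < |α| < p`,
  `∏ᵢ C(dᵢ, αᵢ) = 0` in `K`; `hasseDeriv_eq_zero_of_forall_isPthPowerExponent`.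
* §3 **`hasseDeriv_deletePthPowers`**, **`singLocusIdeal_deletePthPowers`**,
  **`isIsolated_deletePthPowers_iff`** — CLEANING IS INERT for `J_p⁺` and for `IsIsolated p`.

[OURS · counted 0 · AI work weaker than expert review] Nothing here proves `NoIsolatedTrap` or resolution of
singularities in dimension ≥ 4 / characteristic `p`; dictionary bookkeeping for OUR frame.
bears_on: LADDER-RESOLUTION:D157-DOOR2 (res-dim4-pi · F4-I dictionary). Supports stmt-ResolutionOfSingularities-16155
(helper).
-/

set_option linter.dupNamespace false -- mandated namespace of this single-conjunct summit

noncomputable section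

namespace Summit.ResolutionOfSingularities.ResolutionOfSingularities.Theorems.PIDim4

namespace IsolatedBand

open MvPolynomial Finset
open Literature.AlgebraicGeometry.Resolution
open Literature.AlgebraicGeometry.Resolution.Hauser2010

variable {K : Type} [Field K]

/-! ## §1 The coefficient formula for Hasse derivatives -/

/-- If `d − α = e` (truncated) but `d ≠ e + α`, some binomial coefficient `C(dᵢ, αᵢ)` vanishes. [folklore] -/
theorem prod_choose_eq_zero_of_tsub_eq {d α e : Fin 4 →₀ ℕ} (h : d - α = e) (hne : d ≠ e + α) :
    (∏ i, (Nat.choose (d i) (α i) : K)) = 0 := by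
  classical
  have hlt : ∃ i, d i < α i := by
    by_contra hcon
    push Not at hcon
    apply hne
    ext i
    have h2 := DFunLike.congr_fun h i
    rw [Finsupp.tsub_apply] at h2
    rw [Finsupp.add_apply]
    have := hcon i
    omega
  obtain ⟨i, hi⟩ := hlt
  exact Finset.prod_eq_zero (Finset.mem_univ i) (by rw [Nat.choose_eq_zero_of_lt hi, Nat.cast_zero])

/-- **Coefficient formula**: `coeff_e (D^{(α)} F) = (∏ᵢ C(eᵢ + αᵢ, αᵢ)) · coeff_{e+α} F`.
[cite: Giraud1975, §1 (Hasse–Schmidt derivations)] [folklore] -/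
theorem coeff_hasseDeriv (α : Fin 4 →₀ ℕ) (F : MvPolynomial (Fin 4) K) (e : Fin 4 →₀ ℕ) :
    coeff e (hasseDeriv α F) = (∏ i, (Nat.choose (e i + α i) (α i) : K)) * coeff (e + α) F := by
  classical
  unfold hasseDeriv
  rw [coeff_sum]
  simp only [coeff_monomial]
  rw [Finset.sum_eq_single (e + α)]
  · simp only [add_tsub_cancel_right, if_true, Finsupp.add_apply]
  · intro d _ hd
    split_ifs with h
    · rw [prod_choose_eq_zero_of_tsub_eq h hd, zero_mul]
    · rfl
  · intro h
    rw [MvPolynomial.notMem_support_iff.mp h, mul_zero]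
    simp

/-- Hasse derivatives are additive. [folklore] -/
theorem hasseDeriv_add (α : Fin 4 →₀ ℕ) (F G : MvPolynomial (Fin 4) K) :
    hasseDeriv α (F + G) = hasseDeriv α F + hasseDeriv α G := by
  ext e
  rw [coeff_add, coeff_hasseDeriv, coeff_hasseDeriv, coeff_hasseDeriv, coeff_add, mul_add]

/-- `D^{(α)} 0 = 0`. [folklore] -/
theorem hasseDeriv_zero (α : Fin 4 →₀ ℕ) : hasseDeriv α (0 : MvPolynomial (Fin 4) K) = 0 := by
  ext e
  rw [coeff_hasseDeriv, coeff_zero, coeff_zero, mul_zero]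

/-! ## §2 Lucas: `p`-th power monomials are killed by Hasse derivatives of order `< p` -/

/-- **Lucas.** In characteristic `p`, if `p ∣ n` and `0 < a < p` then `C(n, a) = 0` in `K`
(`C(n,a) ≡ C(n mod p, a mod p)·C(n/p, a/p) = C(0,a)·… = 0`). [folklore] -/
theorem natCast_choose_eq_zero_of_dvd (p : ℕ) [hp : Fact p.Prime] [CharP K p] {n a : ℕ} (hn : p ∣ n)
    (ha0 : 0 < a) (hap : a < p) : (Nat.choose n a : K) = 0 := by
  rw [CharP.cast_eq_zero_iff K p]
  have hmod := Choose.choose_modEq_choose_mod_mul_choose_div_nat (n := n) (k := a) (p := p)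
  have hn0 : n % p = 0 := Nat.mod_eq_zero_of_dvd hn
  rw [hn0, Nat.mod_eq_of_lt hap, Nat.choose_eq_zero_of_lt ha0, zero_mul] at hmod
  exact Nat.modEq_zero_iff_dvd.mp hmod

/-- A `p`-th power exponent `d` and `0 < |α| < p`: `∏ᵢ C(dᵢ, αᵢ) = 0` in `K`. [folklore] -/
theorem prod_choose_eq_zero_of_isPthPowerExponent (p : ℕ) [Fact p.Prime] [CharP K p]
    {d α : Fin 4 →₀ ℕ} (hd : IsPthPowerExponent p d) (hα0 : 0 < α.degree) (hαp : α.degree < p) :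
    (∏ i, (Nat.choose (d i) (α i) : K)) = 0 := by
  classical
  obtain ⟨i, hi⟩ : ∃ i, 0 < α i := by
    by_contra hcon
    push Not at hcon
    have : α.degree = 0 := by
      rw [Finsupp.degree_eq_sum]
      exact Finset.sum_eq_zero fun i _ => Nat.le_zero.mp (hcon i)
    omega
  have hαi : α i < p := lt_of_le_of_lt (by
    rw [Finsupp.degree_eq_sum]
    exact Finset.single_le_sum (fun k _ => Nat.zero_le (α k)) (Finset.mem_univ i)) hαp
  have hdi : p ∣ d i := (isPthPowerExponent_iff p d).mp hd i
  exact Finset.prod_eq_zero (Finset.mem_univ i) (natCast_choose_eq_zero_of_dvd p hdi hi hαi)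

/-- A polynomial supported on `p`-th power exponents is killed by every Hasse derivative of order
`0 < |α| < p`. [folklore] -/
theorem hasseDeriv_eq_zero_of_forall_isPthPowerExponent (p : ℕ) [Fact p.Prime] [CharP K p]
    {H : MvPolynomial (Fin 4) K} (hH : ∀ d ∈ H.support, IsPthPowerExponent p d) {α : Fin 4 →₀ ℕ}
    (hα0 : 0 < α.degree) (hαp : α.degree < p) : hasseDeriv α H = 0 := by
  ext e
  rw [coeff_hasseDeriv, coeff_zero]
  by_cases he : e + α ∈ H.support
  · have h0 := prod_choose_eq_zero_of_isPthPowerExponent (K := K) p (hH _ he) hα0 hαp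
    simp only [Finsupp.add_apply] at h0
    rw [h0, zero_mul]
  · rw [MvPolynomial.notMem_support_iff.mp he, mul_zero]

/-! ## §3 Cleaning is inert for `J_p⁺` and for isolation -/

/-- The deleted part of `F` is supported on `p`-th power exponents. [folklore] -/
theorem isPthPowerExponent_of_mem_support_sub_deletePthPowers (p : ℕ) {F : MvPolynomial (Fin 4) K}
    {d : Fin 4 →₀ ℕ} (hd : d ∈ (F - deletePthPowers p F).support) : IsPthPowerExponent p d := by
  classical
  by_contra h
  rw [MvPolynomial.mem_support_iff, coeff_sub, coeff_deletePthPowers, if_neg h, sub_self] at hd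
  exact hd rfl

/-- **Cleaning is inert for Hasse derivatives of order `< p`**: `D^{(α)}(clean F) = D^{(α)} F` for
`0 < |α| < p` in characteristic `p`. [folklore] -/
theorem hasseDeriv_deletePthPowers (p : ℕ) [Fact p.Prime] [CharP K p] (F : MvPolynomial (Fin 4) K)
    {α : Fin 4 →₀ ℕ} (hα0 : 0 < α.degree) (hαp : α.degree < p) :
    hasseDeriv α (deletePthPowers p F) = hasseDeriv α F := by
  have hsplit : F = deletePthPowers p F + (F - deletePthPowers p F) := by ring
  conv_rhs => rw [hsplit, hasseDeriv_add]
  rw [hasseDeriv_eq_zero_of_forall_isPthPowerExponent p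
    (fun d hd => isPthPowerExponent_of_mem_support_sub_deletePthPowers p hd) hα0 hαp, add_zero]

/-- **Cleaning is inert for the `p`-fold locus ideal**: `J_p⁺(clean F) = J_p⁺(F)`. [folklore] -/
theorem singLocusIdeal_deletePthPowers (p : ℕ) [Fact p.Prime] [CharP K p] (F : MvPolynomial (Fin 4) K) :
    singLocusIdeal p (deletePthPowers p F) = singLocusIdeal p F := by
  unfold singLocusIdeal
  congr 1
  ext G
  constructor
  · rintro ⟨α, h0, hp, rfl⟩
    exact ⟨α, h0, hp, hasseDeriv_deletePthPowers p F h0 hp⟩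
  · rintro ⟨α, h0, hp, rfl⟩
    exact ⟨α, h0, hp, (hasseDeriv_deletePthPowers p F h0 hp).symm⟩

/-- **Cleaning is inert for isolation**: the cleaned state is an isolated `p`-fold point iff the uncleaned
one is. [folklore] -/
theorem isIsolated_deletePthPowers_iff (p : ℕ) [Fact p.Prime] [CharP K p] (F : MvPolynomial (Fin 4) K) :
    IsIsolated p (deletePthPowers p F) ↔ IsIsolated p F := by
  unfold IsIsolated
  rw [singLocusIdeal_deletePthPowers]

/-- More generally, adding any polynomial supported on `p`-th power exponents (e.g. `G^p`, or a sum of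
`p`-th power monomials) does not change `J_p⁺`. [folklore] -/
theorem singLocusIdeal_add_of_forall_isPthPowerExponent (p : ℕ) [Fact p.Prime] [CharP K p]
    (F : MvPolynomial (Fin 4) K) {H : MvPolynomial (Fin 4) K}
    (hH : ∀ d ∈ H.support, IsPthPowerExponent p d) : singLocusIdeal p (F + H) = singLocusIdeal p F := by
  unfold singLocusIdeal
  congr 1
  ext G
  constructor
  · rintro ⟨α, h0, hp, rfl⟩
    refine ⟨α, h0, hp, ?_⟩
    rw [hasseDeriv_add, hasseDeriv_eq_zero_of_forall_isPthPowerExponent p hH h0 hp, add_zero]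
  · rintro ⟨α, h0, hp, rfl⟩
    refine ⟨α, h0, hp, ?_⟩
    rw [hasseDeriv_add, hasseDeriv_eq_zero_of_forall_isPthPowerExponent p hH h0 hp, add_zero]

end IsolatedBand

end Summit.ResolutionOfSingularities.ResolutionOfSingularities.Theorems.PIDim4

end
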